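import Summits.HubbardSuperconductivity.HubbardSuperconductivity.Theses.BcsKacWindow
import Summits.HubbardSuperconductivity.HubbardSuperconductivity.Theorems.TwTipContinuation.Negative.TipNormalForm

/-!
# Route `BcsKacWindow` — the elementary cap and the glue items

Four bookkeeping items of route `BcsKacWindow` (sub-problem `HubbardSuperconductivity`):

* `PairDensityBounded` (stmt-HubbardSuperconductivity-1324): for every side `L ≥ 1` and every
  normalised `ψ`, `L⁻⁴ Re⟨ψ, Δ_d† Δ_d ψ⟩ ≤ C`, with the tree's a-priori constant
  `C = (Σ_{e ∈ {0} ∪ unitSteps} 2|g_d(e)|/√2)²` (`expect_pairIntensity_le`: `‖c_{xσ}‖ ≤ 1`,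
  `‖localPair‖ ≤ Σ_e 2|g_d(e)|/√2`).
* `TargetOfWindow` (stmt-HubbardSuperconductivity-14395): `CoherenceWindowLRO → InfraredCompletion →
  Target` — feed the window data verbatim to the transfer; `c := c₁ Δ(U)²`, `L₀ := s₁ / Δ(U)`.
* `StatementOfTarget` (stmt-HubbardSuperconductivity-14396): `Target → PairDensityBounded →
  HubbardSuperconductivity` — take `δ := a`, `U := U₀/2`, and run the even-side `liminf`
  bookkeeping `summitMatrix_of_everyGSOrder` (which carries its own a-priori bound, so the cap
  hypothesis is not even consumed).
* `Assembly` (stmt-HubbardSuperconductivity-1323): the composition of the two.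

Sources: D. J. Scalapino, Phys. Rep. 250 (1995) 329, §2 (order functional);
C. N. Yang, Rev. Mod. Phys. 34 (1962) 694 (a-priori bound on pair correlations). No new definitions.
-/

-- the mandated namespace `Summit.<Summit>.<Problem>.Theorems` repeats `HubbardSuperconductivity`
-- (single-problem summit, D-0017), which the `dupNamespace` linter flags on every declaration
set_option linter.dupNamespace false

namespace Summit.HubbardSuperconductivity.HubbardSuperconductivity.Theorems.BcsKacWindow

open Matrix Literature.MathematicalPhysics.QuantumLattice
open Summit.HubbardSuperconductivity.HubbardSuperconductivity.Theses.BcsKacWindow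
open Summit.HubbardSuperconductivity.TwTipContinuation.Negative
  (summitMatrix_of_everyGSOrder expect_pairIntensity_le)

/-- **Elementary cap** `PairDensityBounded` (stmt-HubbardSuperconductivity-1324): there is `C` with
`L⁻⁴ Re⟨ψ, Δ_d† Δ_d ψ⟩ ≤ C` for every side `L ≥ 1` and every normalised `ψ`; here
`C = (Σ_{e ∈ {0} ∪ unitSteps} 2|g_d(e)|/√2)²` from the operator-norm bound
`expect_pairIntensity_le`. Yang, Rev. Mod. Phys. 34 (1962) 694, §4. [folklore] -/
theorem pairDensityBounded_proof :
    Summit.HubbardSuperconductivity.HubbardSuperconductivity.Theses.BcsKacWindow.PairDensityBounded := by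
  unfold PairDensityBounded
  refine ⟨(∑ e ∈ insert 0 unitSteps, ‖((dWaveFormFactor e / Real.sqrt 2 : ℝ) : ℂ)‖ * 2) ^ 2, ?_⟩
  intro L _ ψ hψ
  have hL : (0 : ℝ) < (L : ℝ) := Nat.cast_pos.2 (Nat.pos_of_ne_zero (NeZero.ne L))
  have hL4 : (0 : ℝ) < (L : ℝ) ^ 4 := by positivity
  rw [div_le_iff₀ hL4]
  exact expect_pairIntensity_le L ψ hψ

/-- **Cruxes ⇒ corner** `TargetOfWindow` (stmt-HubbardSuperconductivity-14395):
`CoherenceWindowLRO → InfraredCompletion → Target`. Destructure the window data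
`(a, b, κ₁, κ₂, c₀, s₀, Δ)` with its pins and window bound, feed them verbatim to the transfer to get
`(c₁, s₁, U₁)`; the corner's witnesses are `a, b, U₀ := U₁` and, at `δ ∈ [a,b]`, `U ∈ (0, U₁)`,
`c := c₁ Δ(U)² > 0` (`Δ(U) ≥ e^{-κ₂/U²} > 0`) and `L₀ := s₁ / Δ(U)`. Scalapino, Phys. Rep. 250
(1995) 329, §2. [folklore] -/
theorem targetOfWindow_proof :
    Summit.HubbardSuperconductivity.HubbardSuperconductivity.Theses.BcsKacWindow.TargetOfWindow := by
  unfold TargetOfWindow CoherenceWindowLRO InfraredCompletion Target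
  rintro ⟨a, b, κ₁, κ₂, c₀, s₀, Δ, ha, hab, hb, hκ₁, hκ, hc₀, hs₀, hpin, hwin⟩ hI
  obtain ⟨c₁, s₁, U₁, hc₁, hU₁, hbulk⟩ :=
    hI a b κ₁ κ₂ c₀ s₀ Δ ha hab hb hκ₁ hκ hc₀ hs₀ hpin hwin
  refine ⟨a, b, U₁, ha, hab, hb, hU₁, fun δ hδ U hU => ?_⟩
  have hΔ : 0 < Δ U := lt_of_lt_of_le (Real.exp_pos _) (hpin U hU.1).1
  refine ⟨c₁ * Δ U ^ 2, s₁ / Δ U, by positivity, fun L _ hE hL₀ ψ hψ hgs => ?_⟩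
  have hsL : s₁ ≤ Δ U * L := by
    rw [div_le_iff₀ hΔ] at hL₀
    linarith [mul_comm (L : ℝ) (Δ U)]
  exact hbulk δ hδ U hU L hE hsL ψ hψ hgs

/-- **Corner ⇒ summit** `StatementOfTarget` (stmt-HubbardSuperconductivity-14396):
`Target → PairDensityBounded → HubbardSuperconductivity`. From the corner take `(a, b, U₀)` and
instantiate `δ := a ∈ (0, 1/2)`, `U := U₀/2 ∈ (0, U₀)`, getting `c > 0` and a real threshold
`L₀`; at every even side `L ≥ ⌈L₀⌉₊` every normalised sector ground state then has
`c L⁴ ≤ Re⟨ψ, Δ_d† Δ_d ψ⟩`, and the even-side `liminf` bookkeeping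
`summitMatrix_of_everyGSOrder` (which carries the a-priori cap keeping Mathlib's real `liminf`
honest) yields the summit's matrix at `(U₀/2, a)`. The cap hypothesis is therefore not consumed.
Scalapino, Phys. Rep. 250 (1995) 329, §2 eq. (2.4). [folklore] -/
theorem statementOfTarget_proof :
    Summit.HubbardSuperconductivity.HubbardSuperconductivity.Theses.BcsKacWindow.StatementOfTarget := by
  unfold StatementOfTarget Target PairDensityBounded
    _root_.HubbardSuperconductivity Literature.Hubbard.DWaveSuperconductivityHubbard
  rintro ⟨a, b, U₀, ha, hab, hb, hU₀, hT⟩ _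
  have hδ : a ∈ Set.Icc a b := ⟨le_rfl, hab.le⟩
  have hU : U₀ / 2 ∈ Set.Ioo (0 : ℝ) U₀ := ⟨by positivity, by linarith⟩
  obtain ⟨c, L₀, hc, hfloor⟩ := hT a hδ (U₀ / 2) hU
  refine ⟨U₀ / 2, hU.1, a, ⟨ha, by linarith⟩, summitMatrix_of_everyGSOrder ⟨c, hc, ⌈L₀⌉₊, ?_⟩⟩
  intro L _ hL₀ hE ψ hψ hgs
  have hL : (0 : ℝ) < (L : ℝ) := Nat.cast_pos.2 (Nat.pos_of_ne_zero (NeZero.ne L))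
  have hL4 : (0 : ℝ) < (L : ℝ) ^ 4 := by positivity
  have hL₀' : L₀ ≤ (L : ℝ) := (Nat.le_ceil L₀).trans (by exact_mod_cast hL₀)
  have h := hfloor L hE hL₀' ψ hψ hgs
  rwa [le_div_iff₀ hL4] at h

/-- **Assembly of route `BcsKacWindow`** (stmt-HubbardSuperconductivity-1323):
`CoherenceWindowLRO → InfraredCompletion → PairDensityBounded → HubbardSuperconductivity`, the
composition `statementOfTarget_proof (targetOfWindow_proof hW hI) hP` (`U := U₁/2`, `δ := a`,
`c := c₁ Δ(U)²`, `L₀ := ⌈s₁ / Δ(U)⌉₊`). Scalapino, Phys. Rep. 250 (1995) 329, §2. [folklore] -/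
theorem bcsKacWindow_assembly_proof :
    Summit.HubbardSuperconductivity.HubbardSuperconductivity.Theses.BcsKacWindow.Assembly := by
  unfold Assembly
  intro hW hI hP
  exact statementOfTarget_proof (targetOfWindow_proof hW hI) hP

end Summit.HubbardSuperconductivity.HubbardSuperconductivity.Theorems.BcsKacWindow
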